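import Literature.Algebra.Lie.SurfaceLieAlgebra
import Literature.GroupTheory.CombinatorialGroupTheory.LowerCentralSeriesLieRing
import HarnessLib

/-!
# The canonical morphism `𝔰_g(ℤ) → gr(π₁Σ_g)` and its surjectivity

Topic `Literature/Algebra/Lie`. Let `S = S_g` be the surface group
(`Literature.Topology.FourManifolds.SurfaceGroup g`) and `gr(S) = ⊕ₙ γ_n(S)/γ_{n+1}(S)` the Lie ring
of its lower central series (`Literature.GroupTheory.CombinatorialGroupTheory.GrLCS`, Mathlib
numbering `γ₀ = S`). Since `∏ᵢ ⁅aᵢ, bᵢ⁆ = 1` in `S`, the symbols `ξ_x = toGr 0 x` of the generators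
satisfy `∑ᵢ ⁅ξ_{aᵢ}, ξ_{bᵢ}⁆ = 0` in `gr(S)`, so the universal property of the surface Lie algebra
`𝔰_g(ℤ) = L(aᵢ, bᵢ)/(∑ ⁅aᵢ, bᵢ⁆)` (`Literature.Algebra.Lie.SurfaceLieAlgebra`) gives the
**canonical Lie ring morphism**

  `SurfaceGr.Phi g : 𝔰_g(ℤ) →ₗ⁅ℤ⁆ gr(S_g)`,  `aᵢ ↦ ξ_{aᵢ}`, `bᵢ ↦ ξ_{bᵢ}`

(Labute, J. Algebra 14 (1970), §1: "the canonical homomorphism of `gr(F)` onto `gr(G)`" composed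
with `gr(F) = L`). This file proves the **easy half of Labute's theorem** for it:
`Phi` maps the degree-`(n+1)` piece `𝔰_{n+1}` ONTO the degree-`n` piece `γ_n/γ_{n+1}` of `gr(S)`
(`Phi_image_grade`: the image of `grade ℤ g (n+1)` is exactly the set of symbols `toGr n x`,
`x ∈ γ_n`), because `γ_n/γ_{n+1}` is generated by the classes of `(n+1)`-fold commutators of
generators. Injectivity (the hard half) is `Literature/Algebra/Lie/SurfaceGroupMagnus.lean`.

Everything is proved; there are no named facts.

## References

* J. P. Labute, On the descending central series of groups with a single defining relation,
  J. Algebra 14 (1970) 16–23, §1. [Labute1970]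
* W. Magnus, A. Karrass, D. Solitar, *Combinatorial Group Theory*, §5.7 (generation of `γ_n/γ_{n+1}`
  by simple commutators).
-/

noncomputable section

namespace Literature.Algebra.Lie

namespace SurfaceGr

open Literature.Topology.FourManifolds
open Literature.GroupTheory.CombinatorialGroupTheory
open SurfaceLieAlgebra
open scoped commutatorElement

variable (g : ℕ)

/-- The symbol of a product of elements of `γ_n` is the sum of the symbols. [folklore] -/
theorem toGr_list_prod {G : Type*} [Group G] (n : ℕ) (l : List G) (hl : ∀ x ∈ l, x ∈ lcs G n) :
    toGr G n l.prod = (l.map (toGr G n)).sum := by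
  induction l with
  | nil => simp
  | cons x l ih =>
    rw [List.prod_cons, List.map_cons, List.sum_cons,
      toGr_mul (hl x List.mem_cons_self) (Subgroup.list_prod_mem _ fun y hy => hl y (List.mem_cons_of_mem x hy)),
      ih fun y hy => hl y (List.mem_cons_of_mem x hy)]

/-- The surface relation holds in `S_g`: `∏ᵢ ⁅aᵢ, bᵢ⁆ = 1`. [folklore] -/
theorem prod_commutator_a_b_eq_one :
    ((List.finRange g).map fun i => ⁅SurfaceGroup.a (g := g) i, SurfaceGroup.b i⁆).prod = 1 := by
  have h : PresentedGroup.mk ({surfaceRelator g} : Set (FreeGroup (surfaceGen g)))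
      (((List.finRange g).map fun i => genA i * genB i * (genA i)⁻¹ * (genB i)⁻¹).prod) = 1 :=
    PresentedGroup.one_of_mem (Set.mem_singleton (surfaceRelator g))
  rw [map_list_prod, List.map_map] at h
  refine Eq.trans ?_ h
  congr 1

/-- In `gr(S_g)`: `∑ᵢ ⁅ξ_{aᵢ}, ξ_{bᵢ}⁆ = 0`. [folklore] -/
theorem sum_lie_symbols_eq_zero :
    ∑ i : Fin g, ⁅toGr (SurfaceGroup g) 0 (SurfaceGroup.a i), toGr (SurfaceGroup g) 0 (SurfaceGroup.b i)⁆ = 0 := by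
  have h1 : ∀ i : Fin g, ⁅toGr (SurfaceGroup g) 0 (SurfaceGroup.a i), toGr (SurfaceGroup g) 0 (SurfaceGroup.b i)⁆ =
      toGr (SurfaceGroup g) 1 ⁅SurfaceGroup.a i, SurfaceGroup.b i⁆ :=
    fun i => lie_toGr_toGr (Subgroup.mem_top _) (Subgroup.mem_top _)
  simp only [h1]
  rw [Fin.sum_univ_def]
  have hl : ∀ x ∈ (List.finRange g).map (fun i => ⁅SurfaceGroup.a (g := g) i, SurfaceGroup.b i⁆),
      x ∈ lcs (SurfaceGroup g) 1 := by
    intro x hx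
    obtain ⟨i, -, rfl⟩ := List.mem_map.1 hx
    exact commutator_mem_lcs_succ (Subgroup.mem_top _) _
  have := toGr_list_prod 1 _ hl
  rw [prod_commutator_a_b_eq_one, toGr_one, List.map_map] at this
  exact this.symm

/-- **The canonical morphism `Φ : 𝔰_g(ℤ) → gr(S_g)`**, generators to the symbols of the generators.
[cite: Labute1970, §1 (the canonical homomorphism gr(F) → gr(G))] -/
def Phi : SurfaceLieAlgebra ℤ g →ₗ⁅ℤ⁆ GrLCS (SurfaceGroup g) :=
  SurfaceLieAlgebra.lift (fun x => toGr (SurfaceGroup g) 0 (PresentedGroup.of x)) (sum_lie_symbols_eq_zero g)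

/-- `Φ` on generators. [folklore] -/
@[simp] theorem Phi_gen (x : Fin g × Bool) : Phi g (gen ℤ g x) = toGr (SurfaceGroup g) 0 (PresentedGroup.of x) :=
  lift_gen _ _ x

/-- The iterated group commutator `⟦w⟧` of a bracket shape `w` in the generators of `S_g`. [folklore] -/
def commWord : FreeMagma (Fin g × Bool) → SurfaceGroup g
  | FreeMagma.of x => PresentedGroup.of x
  | u * v => ⁅commWord u, commWord v⁆

/-- A shape of length `n` gives a commutator in `γ_{n-1}`. [folklore] -/
theorem commWord_mem (w : FreeMagma (Fin g × Bool)) : commWord g w ∈ lcs (SurfaceGroup g) (w.length - 1) := by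
  induction w using FreeMagma.recOnMul with
  | ih1 x => exact Subgroup.mem_top _
  | ih2 u v hu hv =>
    have h1 := FreeMagma.length_pos u
    have h2 := FreeMagma.length_pos v
    change ⁅commWord g u, commWord g v⁆ ∈ lcs (SurfaceGroup g) (u.length + v.length - 1)
    exact commutator_mem_lcs_of_eq (by omega) hu hv

/-- `Φ` of an iterated bracket is the symbol of the iterated commutator. [folklore] -/
theorem Phi_bracketWord (w : FreeMagma (Fin g × Bool)) :
    Phi g (bracketWord (gen ℤ g) w) = toGr (SurfaceGroup g) (w.length - 1) (commWord g w) := by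
  induction w using FreeMagma.recOnMul with
  | ih1 x => exact Phi_gen g x
  | ih2 u v hu hv =>
    have h1 := FreeMagma.length_pos u
    have h2 := FreeMagma.length_pos v
    rw [bracketWord_mul, LieHom.map_lie, hu, hv]
    change _ = toGr (SurfaceGroup g) (u.length + v.length - 1) ⁅commWord g u, commWord g v⁆
    exact lie_toGr_toGr_of_eq (by omega) (commWord_mem g u) (commWord_mem g v)

/-- `Φ(𝔰_{n+1})` consists of symbols of degree `n`. [folklore] -/
theorem Phi_mem_range_of {n : ℕ} {u : SurfaceLieAlgebra ℤ g} (hu : u ∈ grade ℤ g (n + 1)) :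
    Phi g u ∈ (GrLCS.of (SurfaceGroup g) n).range := by
  change u ∈ wordGrade ℤ (gen ℤ g) (n + 1) at hu
  refine Submodule.span_induction (p := fun u _ => Phi g u ∈ (GrLCS.of (SurfaceGroup g) n).range) ?_ ?_ ?_ ?_ hu
  · rintro _ ⟨w, hw, rfl⟩
    change w.length = n + 1 at hw
    rw [Phi_bracketWord, show w.length - 1 = n by omega]
    have := GrLCS.toGr_mem_range_of (commWord_mem g w)
    rwa [show w.length - 1 = n by omega] at this
  · rw [map_zero]; exact zero_mem _
  · intro u v _ _ hu hv; rw [map_add]; exact add_mem hu hv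
  · intro c u _ hu; rw [map_smul]; exact AddSubgroup.zsmul_mem _ hu c

/-- Every symbol `ξ_x`, `x ∈ S`, of degree `0` is `Φ` of an element of `𝔰₁`. [folklore] -/
theorem exists_Phi_eq_toGr_zero (x : SurfaceGroup g) : ∃ u ∈ grade ℤ g 1, Phi g u = toGr (SurfaceGroup g) 0 x := by
  have hx : x ∈ Subgroup.closure (Set.range (PresentedGroup.of : Fin g × Bool → SurfaceGroup g)) := by
    rw [PresentedGroup.closure_range_of]; exact Subgroup.mem_top x
  refine Subgroup.closure_induction (p := fun x _ => ∃ u ∈ grade ℤ g 1, Phi g u = toGr (SurfaceGroup g) 0 x)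
    ?_ ?_ ?_ ?_ hx
  · rintro _ ⟨y, rfl⟩
    exact ⟨gen ℤ g y, gen_mem_grade_one ℤ g y, Phi_gen g y⟩
  · exact ⟨0, Submodule.zero_mem _, by rw [map_zero, toGr_one]⟩
  · rintro x y - - ⟨u, hu, hux⟩ ⟨v, hv, hvy⟩
    exact ⟨u + v, add_mem hu hv, by rw [map_add, hux, hvy, toGr_mul (Subgroup.mem_top x) (Subgroup.mem_top y)]⟩
  · rintro x - ⟨u, hu, hux⟩
    exact ⟨-u, Submodule.neg_mem _ hu, by rw [map_neg, hux, toGr_inv (Subgroup.mem_top x)]⟩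

/-- **Surjectivity of `Φ` onto symbols**: every symbol `toGr n x`, `x ∈ γ_n(S)`, is `Φ` of an element of
`𝔰_{n+1}` (the classes of `(n+1)`-fold commutators of generators generate `γ_n/γ_{n+1}`).
[cite: Labute1970, §1 (gr(F) → gr(G) is onto)] -/
theorem exists_Phi_eq_toGr (n : ℕ) : ∀ x ∈ lcs (SurfaceGroup g) n,
    ∃ u ∈ grade ℤ g (n + 1), Phi g u = toGr (SurfaceGroup g) n x := by
  induction n with
  | zero => intro x _; exact exists_Phi_eq_toGr_zero g x
  | succ n ih =>
    intro x hx
    have hx' : x ∈ Subgroup.closure {z | ∃ p ∈ lcs (SurfaceGroup g) n, ∃ q ∈ (⊤ : Subgroup (SurfaceGroup g)), ⁅p, q⁆ = z} := by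
      rwa [← Subgroup.commutator_def]
    refine Subgroup.closure_induction
      (p := fun x hx => ∃ u ∈ grade ℤ g (n + 1 + 1), Phi g u = toGr (SurfaceGroup g) (n + 1) x) ?_ ?_ ?_ ?_ hx'
    · rintro _ ⟨p, hp, q, -, rfl⟩
      obtain ⟨u, hu, hup⟩ := ih p hp
      obtain ⟨v, hv, hvq⟩ := exists_Phi_eq_toGr_zero g q
      refine ⟨⁅u, v⁆, lie_mem_grade ℤ g hu hv, ?_⟩
      rw [LieHom.map_lie, hup, hvq, lie_toGr_toGr hp (Subgroup.mem_top q)]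
    · exact ⟨0, Submodule.zero_mem _, by rw [map_zero, toGr_one]⟩
    · rintro x y hx hy ⟨u, hu, hux⟩ ⟨v, hv, hvy⟩
      have hx2 : x ∈ lcs (SurfaceGroup g) (n + 1) := by rwa [← Subgroup.commutator_def] at hx
      have hy2 : y ∈ lcs (SurfaceGroup g) (n + 1) := by rwa [← Subgroup.commutator_def] at hy
      exact ⟨u + v, add_mem hu hv, by rw [map_add, hux, hvy, toGr_mul hx2 hy2]⟩
    · rintro x hx ⟨u, hu, hux⟩
      have hx2 : x ∈ lcs (SurfaceGroup g) (n + 1) := by rwa [← Subgroup.commutator_def] at hx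
      exact ⟨-u, Submodule.neg_mem _ hu, by rw [map_neg, hux, toGr_inv hx2]⟩

/-- **`Φ(𝔰_{n+1})` is exactly the set of degree-`n` symbols** `{toGr n x | x ∈ γ_n}` (= the piece
`γ_n/γ_{n+1}` inside `gr(S_g)`). [cite: Labute1970, §1] -/
theorem Phi_image_grade (n : ℕ) :
    Phi g '' (grade ℤ g (n + 1) : Set (SurfaceLieAlgebra ℤ g)) = (GrLCS.of (SurfaceGroup g) n).range := by
  ext a
  constructor
  · rintro ⟨u, hu, rfl⟩; exact Phi_mem_range_of g hu
  · intro ha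
    obtain ⟨x, hx, rfl⟩ := GrLCS.exists_toGr_of_mem_range ha
    obtain ⟨u, hu, hux⟩ := exists_Phi_eq_toGr g n x hx
    exact ⟨u, hu, hux⟩

end SurfaceGr

end Literature.Algebra.Lie
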